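import Summits.CriticalPhenomena.PercolationContinuityZ3.Theorems.Transplant.SiteTwoMaxArea
import Mathlib.GroupTheory.SemidirectProduct
import Mathlib.Data.ZMod.Basic
import HarnessLib

/-!
# The groups `Γ_p = ℤ^p ⋊ C_p` (the cyclic group permuting the coordinates) — DEFINITIONS for the type-number lower bound of the end-state node:
# the shift action, the lattice of a subgroup and the character it inherits

builds on p205010 (kernel theorem, internal audit signed; external expert review pending) — nothing in this file uses p205010; nothing here is a
claim about any open node.  Lane `prim-bschramm`, seat `prim-bschramm-p4` gen 28 (PART C3 of `P4-GENERAL.md` §50: THE END-STATE NODE CANNOT BE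
BOUNDED IN THE NUMBER OF TYPES).  Helper file (`--supports stmt-CriticalPhenomena-4575 --as helper`).  DEFINITIONS + their `simp` API only; the
theorems are in the sequel `AutEndStateTypes`.

* `ZWr.Lat p = Multiplicative (ZMod p → ℤ)` (the lattice `ℤ^p`, coordinates indexed by `ℤ/p`, written multiplicatively), `ZWr.Rot p =
  Multiplicative (ZMod p)` (the cyclic group `C_p`), `ZWr.shift p h` (the coordinate shift `v ↦ v(· − h)` as a multiplicative automorphism),
  `ZWr.shiftHom p : C_p →* Aut(ℤ^p)`, and **`ZWr.Grp p = ℤ^p ⋊ C_p`** (Mathlib's `SemidirectProduct`; the restricted wreath product `ℤ ≀ C_p`):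
  finitely generated, virtually `ℤ^p` (polynomial growth of degree `p`, `p_c < 1` on every Cayley graph for `p ≥ 2`), `b₁(Γ_p) = 1`, `vb₁(Γ_p) = p`.
* `ZWr.conj_inl` — conjugating a lattice element by `x` shifts it by `x.right` (the lattice is abelian).
* `ZWr.latticeOf A₀` — for a subgroup `A₀ ≤ Γ_p`, the additive subgroup `{v : ℤ^p | inl v ∈ A₀}` of `ℤ^p`; `ZWr.charOf A₀ c` — the additive map
  it inherits from a character `c : A₀ → ℤ²` (`v ↦ c(inl v)`).
[cite: BenjaminiSchramm1996, Conj. 4; §2 (almost transitive graphs)] [cite: LeemannDelasalle2022, Cor. 1.2 (which finitely generated groups admit a GRR)]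
-/

noncomputable section

namespace Summit.CriticalPhenomena.PercolationContinuityZ3.Theorems.Transplant

open Literature.Probability.LatticeModels

namespace ZWr

variable (p : ℕ)

/-! ## §1 The lattice, the rotation group, the shift action, the group -/

/-- The lattice `ℤ^p` with coordinates indexed by `ℤ/p`, written multiplicatively. [folklore] -/
abbrev Lat : Type := Multiplicative (ZMod p → ℤ)

/-- The cyclic group `C_p = ℤ/p`, written multiplicatively. [folklore] -/
abbrev Rot : Type := Multiplicative (ZMod p)

/-- **The coordinate shift by `h`**: `(shift h v)(i) = v(i − h)`, a multiplicative automorphism of `ℤ^p`. [folklore] -/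
def shift (h : ZMod p) : MulAut (Lat p) where
  toFun v := Multiplicative.ofAdd fun i => Multiplicative.toAdd v (i - h)
  invFun v := Multiplicative.ofAdd fun i => Multiplicative.toAdd v (i + h)
  left_inv v := by
    apply Multiplicative.toAdd.injective
    funext i
    simp only [toAdd_ofAdd, add_sub_cancel_right]
  right_inv v := by
    apply Multiplicative.toAdd.injective
    funext i
    simp only [toAdd_ofAdd, sub_add_cancel]
  map_mul' v w := by
    apply Multiplicative.toAdd.injective
    funext i
    simp only [toAdd_ofAdd, toAdd_mul, Pi.add_apply]

/-- The shift, coordinatewise. [folklore] -/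
@[simp] theorem toAdd_shift_apply (h : ZMod p) (v : Lat p) (i : ZMod p) :
    Multiplicative.toAdd (shift p h v) i = Multiplicative.toAdd v (i - h) := rfl

/-- **The action `C_p → Aut(ℤ^p)` by coordinate shifts** (a homomorphism: shifting by `g + h` is shifting by `h`, then by `g`). [folklore] -/
def shiftHom : Rot p →* MulAut (Lat p) where
  toFun g := shift p (Multiplicative.toAdd g)
  map_one' := MulEquiv.ext fun v => Multiplicative.toAdd.injective (funext fun i => by
    simp only [toAdd_one, toAdd_shift_apply, sub_zero, MulAut.one_apply])
  map_mul' g h := MulEquiv.ext fun v => Multiplicative.toAdd.injective (funext fun i => by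
    simp only [toAdd_mul, toAdd_shift_apply, MulAut.mul_apply, sub_sub])

/-- The action, coordinatewise. [folklore] -/
@[simp] theorem toAdd_shiftHom_apply (g : Rot p) (v : Lat p) (i : ZMod p) :
    Multiplicative.toAdd (shiftHom p g v) i = Multiplicative.toAdd v (i - Multiplicative.toAdd g) := rfl

/-- **`Γ_p = ℤ^p ⋊ C_p`** — the cyclic group of order `p` permuting the coordinates of `ℤ^p` cyclically (the restricted wreath product `ℤ ≀ C_p`).
[cite: LeemannDelasalle2022, Cor. 1.2] -/
abbrev Grp : Type := Lat p ⋊[shiftHom p] Rot p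

variable {p}

/-- **Conjugating a lattice element shifts it**: `x · inl v · x⁻¹ = inl (shift_{x.right} v)` (the lattice is abelian, so the `x.left`-part cancels).
[folklore] -/
theorem conj_inl (x : Grp p) (v : Lat p) :
    x * SemidirectProduct.inl v * x⁻¹ = SemidirectProduct.inl (shiftHom p x.right v) := by
  refine SemidirectProduct.ext ?_ ?_
  · apply Multiplicative.toAdd.injective
    funext i
    simp only [SemidirectProduct.mul_left, SemidirectProduct.mul_right, SemidirectProduct.left_inl, SemidirectProduct.right_inl,
      SemidirectProduct.inv_left, mul_one, toAdd_mul, toAdd_inv, Pi.add_apply, Pi.neg_apply, toAdd_shiftHom_apply, sub_neg_eq_add,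
      sub_add_cancel]
    ring
  · simp only [SemidirectProduct.mul_right, SemidirectProduct.right_inl, SemidirectProduct.inv_right, mul_one, mul_inv_cancel]

/-- An element with trivial rotation part is the lattice element `inl x.left`. [folklore] -/
theorem eq_inl_of_right_eq_one {x : Grp p} (h : x.right = 1) : x = SemidirectProduct.inl x.left :=
  SemidirectProduct.ext rfl h

/-! ## §2 The lattice of a subgroup and the character it inherits -/

/-- **The lattice of a subgroup `A₀ ≤ Γ_p`**: the additive subgroup `{v : ℤ^p | inl v ∈ A₀}` of `ℤ^p`. [folklore] -/
def latticeOf (A₀ : Subgroup (Grp p)) : AddSubgroup (ZMod p → ℤ) where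
  carrier := {v | (SemidirectProduct.inl (Multiplicative.ofAdd v) : Grp p) ∈ A₀}
  zero_mem' := by
    show SemidirectProduct.inl (Multiplicative.ofAdd (0 : ZMod p → ℤ)) ∈ A₀
    rw [ofAdd_zero, map_one]; exact one_mem A₀
  add_mem' := by
    intro v w hv hw
    show SemidirectProduct.inl (Multiplicative.ofAdd (v + w)) ∈ A₀
    rw [ofAdd_add, map_mul]; exact mul_mem hv hw
  neg_mem' := by
    intro v hv
    show SemidirectProduct.inl (Multiplicative.ofAdd (-v)) ∈ A₀
    rw [ofAdd_neg, map_inv]; exact inv_mem hv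

/-- Membership in the lattice of `A₀`. [folklore] -/
theorem mem_latticeOf {A₀ : Subgroup (Grp p)} {v : ZMod p → ℤ} :
    v ∈ latticeOf A₀ ↔ (SemidirectProduct.inl (Multiplicative.ofAdd v) : Grp p) ∈ A₀ := Iff.rfl

/-- A lattice vector of `A₀`, as an element of `Γ_p`, lies in `A₀` (the membership, with its type spelled as `A₀`-membership). [folklore] -/
theorem inl_ofAdd_mem {A₀ : Subgroup (Grp p)} (v : latticeOf A₀) :
    (SemidirectProduct.inl (Multiplicative.ofAdd (v : ZMod p → ℤ)) : Grp p) ∈ A₀ := v.2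

/-- **The character inherited by the lattice**: `v ↦ c(inl v)` for a character `c : A₀ → ℤ²`, as an additive map `latticeOf A₀ →+ ℤ²`.
[folklore] -/
def charOf (A₀ : Subgroup (Grp p)) (c : A₀ →* Multiplicative (Site 2)) : latticeOf A₀ →+ Site 2 where
  toFun v := Multiplicative.toAdd (c ⟨SemidirectProduct.inl (Multiplicative.ofAdd (v : ZMod p → ℤ)), inl_ofAdd_mem v⟩)
  map_zero' := by
    have h : (⟨SemidirectProduct.inl (Multiplicative.ofAdd ((0 : latticeOf A₀) : ZMod p → ℤ)), inl_ofAdd_mem (0 : latticeOf A₀)⟩ : A₀) = 1 :=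
      Subtype.ext (by simp only [AddSubgroup.coe_zero, ofAdd_zero, map_one, Subgroup.coe_one])
    rw [h, map_one, toAdd_one]
  map_add' v w := by
    have h : (⟨SemidirectProduct.inl (Multiplicative.ofAdd ((v + w : latticeOf A₀) : ZMod p → ℤ)), inl_ofAdd_mem (v + w)⟩ : A₀) =
        ⟨SemidirectProduct.inl (Multiplicative.ofAdd (v : ZMod p → ℤ)), inl_ofAdd_mem v⟩ * ⟨SemidirectProduct.inl (Multiplicative.ofAdd (w : ZMod p → ℤ)), inl_ofAdd_mem w⟩ :=
      Subtype.ext (by simp only [AddSubgroup.coe_add, ofAdd_add, map_mul, Subgroup.coe_mul])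
    rw [h, map_mul, toAdd_mul]

/-- The inherited character, evaluated. [folklore] -/
theorem charOf_apply (A₀ : Subgroup (Grp p)) (c : A₀ →* Multiplicative (Site 2)) (v : latticeOf A₀) :
    charOf A₀ c v = Multiplicative.toAdd (c ⟨SemidirectProduct.inl (Multiplicative.ofAdd (v : ZMod p → ℤ)), inl_ofAdd_mem v⟩) := rfl

end ZWr

end Summit.CriticalPhenomena.PercolationContinuityZ3.Theorems.Transplant

end
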